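import Literature.IUT.LogThetaLattice.LatticeGlue
import Literature.IUT.LogThetaLattice.BiCoresCompat
import Literature.IUT.LogThetaLattice.BiCoresRealified
import HarnessLib

/-!
# [IUTchIII] Theorem 1.5 (iv), (v) ON THE GLUED LOG-THETA-LATTICE: bi-coric mono-analytic log-shells and
# bi-coric realified Frobenioids induced by the ACTUAL vertical / horizontal arrows (proof-only companion)

Mochizuki, *Inter-universal Teichmüller Theory III*, kurims manuscript (May 2020), §1, Thm 1.5 (iv) p.50,
(v) pp.50–51, with [IUTchII] Cor 4.10 (iv), (v) p.160 [claim: Mochizuki2012, status: disputed] (D-0012 claim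
key; record-only; nothing here takes a side on anything).

Discharge-wave companion (abc-iut cell, D-0067 cone of [IUTchIII] Cor 3.12; DISCHARGE-L6 §F row F12-b, nodes
`IUTchIII:Thm1.5(iv)`, `IUTchIII:Thm1.5(v)`; SUBDAG-IUTchIII-Thm-15 rows r10–r14). WHAT THIS FILE ADDS. The
statement files `BiCores` / `BiCoresCompat` / `BiCoresRealified` (abc-iut-L6-t3) type Thm 1.5 (iv)(v) over the
interface `BiCoricData` with the bi-coricity poly-isomorphisms taken to be those "induced by the FULL
poly-isomorphism `^{n,m}D^⊢_△ ⥲ ^{n′,m′}D^⊢_△`" (`biCoricShellPolyIso`, `biCoricRealifiedPolyIso`), and prove the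
printed compatibilities at that level (`thm15iv_compat_viii`, `shellKummerAt_compat_ii`,
`thm15vSingleIso_iff_rigid`, `realifiedTransport_eq_orbit`). Print, however, says the poly-isomorphisms of
`D^⊢`-prime-strips are "induced by the full poly-isomorphisms of (i), (ii)" — i.e. by the ACTUAL vertical arrows
(full log-links, Def 1.4 / Thm 1.5 (i): `LogThetaLatticeDiagram.vertical`, `HodgeTheaterLogLink`) and the ACTUAL
horizontal arrows (the `Θ^{×μ}`- and `Θ^{×μ}_{gau}`-links of [IUTchII] Cor 4.10 (iii) and the poly-isomorphism of
`F^{⊢×μ}`-prime-strips they induce, Thm 1.5 (ii): `ThetaLinkData.linkInducedFxm`) of a log-theta-lattice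
`Λ : LogThetaLatticeDiagram`. The file `LatticeGlue` (p408480) records that these live on ONE frame together with
`BiCoricData` (identification isomorphism `fxmDeltaHT_iso`; Kummer isomorphisms `BiCoricData.kummerAt`). Over a glue
`G : LatticeGlue S` and a lattice `Λ` this file PROVES, with fully-qualified types and no new definition:
* the `D^⊢_△`-poly-isomorphism induced by a HORIZONTAL arrow of `Λ` — Thm 1.5 (ii)'s poly-isomorphism
  `^{n,m}F^{⊢×μ}_△ ⥲ ^{n+1,m}F^{⊢×μ}_△` transported along the Kummer isomorphisms of (iii) and read on underlying
  `D^⊢`-prime-strips — IS the full poly-isomorphism `^{n,m}D^⊢_△ ⥲ ^{n+1,m}D^⊢_△` ([IUTchII] Cor 4.10 (iv), last clause)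
  (`LatticeGlue.horizontal_inducedDv_full`, via `dvConj_kummerTransport_glue`); hence it induces EXACTLY the bi-coric poly-isomorphisms of
  (iv) (`thm15iv_of_horizontal`) and of (v) (`thm15v_of_horizontal`), and the `F^{⊢×μ}_△(−)`-level one of (iii)
  (`thm15iii_of_horizontal`);
* the `D^⊢_△`-poly-isomorphism induced by a VERTICAL arrow (Thm 1.5 (i): the full poly-isomorphism of `D`-Hodge
  theaters, pushed along `†HT^D ↦ †D^⊢_△`) is nonempty and induces poly-isomorphisms CONTAINED in those of (iv), (v)
  (`thm15iv_of_vertical`, `thm15v_of_vertical`) — "for arbitrary `n, m, n′, m′`" by composing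
  (`thm15iv_of_vertical_horizontal`, `thm15v_of_vertical_horizontal`);
* (iv), last sentence, with the ACTUAL arrow of (ii): the square `{I_{^{n,m}D^⊢_△}} ⥲ {I_{^{n+1,m}D^⊢_△}}` / first arrows
  (Kummer) / image under `I_{(−)}` of Thm 1.5 (ii)'s poly-isomorphism transported to `BiCores`' copy COMMUTES
  (`thm15iv_compat_ii_glue`, from `shellKummerAt_compat_ii`);
* (v) "AN isomorphism … for `n, m, n′, m′ ∈ ℤ`" along the lattice under the named [IUTchII] Cor 4.10 (v) rigidity
  slot `BiCoricData.RealifiedRigidAt` (the [IUTchII]-side statement is not yet typed — abc-iut-L6-t2/t6,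
  `ThetaGauLinks` header; it enters BY NAME, never inlined) (`thm15v_singleIso_lattice`), and (v)'s compatibility
  "relative to the horizontal arrows … with the `ℝ_{>0}`-orbits … of [IUTchII] Cor 4.6 (ii)" with the horizontal
  arrow's own constituents (`thm15v_orbit_compat_horizontal`).
Deliberately NOT here: Thm 1.5 (i)(ii) themselves (row F7), (iii) proper (row F12-a), any [IUTchII]-side
construction.
-/

namespace Literature.IUT.LogThetaLattice

open CategoryTheory
open Literature.IUT.HodgeTheaters

universe u

namespace LatticeGlue

variable {S : StripFrame.{u}} (G : LatticeGlue S) (Λ : LogThetaLatticeDiagram G.logData G.linkData)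

/-! ### The `D^⊢_△`-poly-isomorphisms induced by the arrows of the lattice -/

/-- **IUTchIII:Thm1.5(iv)** (kurims p.50; input Thm 1.5 (ii)(iii), [IUTchII] Cor 4.10 (iv) p.160) reading a
Frobenius-like isomorphism `^{n,m}F^{⊢×μ}_△ ⥲ ^{n′,m′}F^{⊢×μ}_△` (on `HodgeTheaterLogLink`'s copy `ThetaLinkData.fxmDelta`)
on the underlying `D^⊢`-prime-strips `^{n,m}D^⊢_△ ⥲ ^{n′,m′}D^⊢_△`: carry it to `BiCores`' copy of `†F^{⊢×μ}_△` along the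
glue isomorphism `fxmDeltaHT_iso`, transport along the Kummer isomorphisms of (iii) (`BiCoricData.kummerTransport`)
to the bi-coric strips `F^{⊢×μ}_△(^{n,m}D^⊢_△)`, then take the underlying `D^⊢`-isomorphism (`BiCoricData.dvConj`). For a
`D^⊢_△`-induced isomorphism this returns the inducing one. [claim: Mochizuki2012, status: disputed] -/
theorem dvConj_kummerTransport_glue (X Y : S.HT)
    (d : G.biCoric.dvDeltaOf (S.htToD.obj X) ≅ G.biCoric.dvDeltaOf (S.htToD.obj Y)) :
    G.biCoric.dvConj (G.biCoric.kummerTransport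
      (G.fxmDeltaHT_iso.app X ≪≫
        ((G.fxmDeltaHT_iso.app X).symm ≪≫
          (G.biCoric.kummerAt X ≪≫ G.biCoric.fxmOfDv.mapIso d ≪≫ (G.biCoric.kummerAt Y).symm) ≪≫
            G.fxmDeltaHT_iso.app Y) ≪≫
        (G.fxmDeltaHT_iso.app Y).symm)) = d := by
  have h : G.biCoric.kummerTransport
      (G.fxmDeltaHT_iso.app X ≪≫
        ((G.fxmDeltaHT_iso.app X).symm ≪≫
          (G.biCoric.kummerAt X ≪≫ G.biCoric.fxmOfDv.mapIso d ≪≫ (G.biCoric.kummerAt Y).symm) ≪≫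
            G.fxmDeltaHT_iso.app Y) ≪≫
        (G.fxmDeltaHT_iso.app Y).symm) = G.biCoric.fxmOfDv.mapIso d := by
    simp only [BiCoricData.kummerTransport, Iso.trans_assoc, Iso.self_symm_id_assoc, Iso.symm_self_id_assoc,
      Iso.self_symm_id, Iso.symm_self_id, Iso.trans_refl]
  rw [h]
  exact G.biCoric.dvConj_mapIso d

/-- **IUTchIII:Thm1.5(iv)** (kurims p.50; [IUTchII] Cor 4.10 (iv) p.160 "this full poly-isomorphism induces the full
poly-isomorphism `†D^⊢_△ ⥲ ‡D^⊢_△`") for the HORIZONTAL arrow `^{n,m}HT → ^{n+1,m}HT` of the lattice `Λ`: the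
poly-isomorphism of `F^{⊢×μ}`-prime-strips it induces (Thm 1.5 (ii), `ThetaLinkData.linkInducedFxm`), transported along
the Kummer isomorphisms of (iii) and read on underlying `D^⊢`-prime-strips, is the FULL poly-isomorphism
`^{n,m}D^⊢_△ ⥲ ^{n+1,m}D^⊢_△`. [claim: Mochizuki2012, status: disputed] -/
theorem horizontal_inducedDv_full (n m : ℤ) :
    (fun e => G.biCoric.dvConj (G.biCoric.kummerTransport
        (G.fxmDeltaHT_iso.app (Λ.HT (n, m)) ≪≫ e ≪≫ (G.fxmDeltaHT_iso.app (Λ.HT (n + 1, m))).symm))) ''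
      (G.linkData.linkInducedFxm Λ.kind (Λ.HT (n, m)) (Λ.HT (n + 1, m))) =
    PolyIso.full (G.biCoric.dvDeltaOf (S.htToD.obj (Λ.HT (n, m))))
      (G.biCoric.dvDeltaOf (S.htToD.obj (Λ.HT (n + 1, m)))) := by
  rw [G.linkData.linkInducedFxm_full]
  ext d
  simp only [Set.mem_image, PolyIso.mem_full, true_and, iff_true]
  exact ⟨(G.fxmDeltaHT_iso.app _).symm ≪≫
      (G.biCoric.kummerAt _ ≪≫ G.biCoric.fxmOfDv.mapIso d ≪≫ (G.biCoric.kummerAt _).symm) ≪≫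
        G.fxmDeltaHT_iso.app _,
    G.dvConj_kummerTransport_glue (Λ.HT (n, m)) (Λ.HT (n + 1, m)) d⟩

/-- **IUTchIII:Thm1.5(iv)** (kurims p.50; input Thm 1.5 (i) p.48) for the VERTICAL arrow `^{n,m}HT --log--> ^{n,m+1}HT` of
`Λ`: the poly-isomorphism `^{n,m}D^⊢_△ ⥲ ^{n,m+1}D^⊢_△` induced, through `†HT^D ↦ †D^⊢_△` ([IUTchII] Cor 4.10 (i)), by the
FULL poly-isomorphism of `D`-Hodge theaters of Thm 1.5 (i) is nonempty … [claim: Mochizuki2012, status: disputed] -/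
theorem vertical_inducedDv_nonempty (n m : ℤ) :
    (((Λ.vertical n m).inducedDHT).map G.biCoric.dvDelta).Nonempty := by
  rw [Λ.vertical_inducedDHT_full]
  exact (S.full_nonempty_DHT _ _).image _

/-- **IUTchIII:Thm1.5(iv)** (kurims p.50) … and (trivially) contained in the full poly-isomorphism of
`D^⊢`-prime-strips, the one the bi-coricity poly-isomorphisms of `BiCores` are built from.
[claim: Mochizuki2012, status: disputed] -/
theorem vertical_inducedDv_subset_full (n m : ℤ) :
    ((Λ.vertical n m).inducedDHT).map G.biCoric.dvDelta ⊆
      PolyIso.full (G.biCoric.dvDeltaOf (S.htToD.obj (Λ.HT (n, m))))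
        (G.biCoric.dvDeltaOf (S.htToD.obj (Λ.HT (n, m + 1)))) :=
  Set.subset_univ _

/-! ### Thm 1.5 (iii) at the `F^{⊢×μ}_△(−)` level, (iv) at the log-shell level, (v) at the realified level -/

/-- **IUTchIII:Thm1.5(iv)** (kurims p.49–50; the (iii)-level form used by (iv)(v)) the horizontal arrow of `Λ`
induces, through `F^{⊢×μ}_△(−)`, exactly `BiCores`' horizontal-type poly-isomorphism
`F^{⊢×μ}_△(^{n,m}D^⊢_△) ⥲ F^{⊢×μ}_△(^{n+1,m}D^⊢_△)` (`BiCoricData.horizontalPolyIso`). [claim: Mochizuki2012, status: disputed] -/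
theorem thm15iii_of_horizontal (n m : ℤ) :
    PolyIso.map G.biCoric.fxmOfDv
      ((fun e => G.biCoric.dvConj (G.biCoric.kummerTransport
        (G.fxmDeltaHT_iso.app (Λ.HT (n, m)) ≪≫ e ≪≫ (G.fxmDeltaHT_iso.app (Λ.HT (n + 1, m))).symm))) ''
        (G.linkData.linkInducedFxm Λ.kind (Λ.HT (n, m)) (Λ.HT (n + 1, m)))) =
    G.biCoric.horizontalPolyIso (S.htToD.obj (Λ.HT (n, m))) (S.htToD.obj (Λ.HT (n + 1, m))) := by
  rw [G.horizontal_inducedDv_full Λ n m]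
  rfl

/-- **IUTchIII:Thm1.5(iv)** (kurims p.50) "The poly-isomorphisms that constitute the bi-coricity property discussed in
(iii) induce poly-isomorphisms `{I_{^{n,m}D^⊢_△} ⊆ log(^{n,m}D^⊢_△)} ⥲ {I_{^{n′,m′}D^⊢_△} ⊆ log(^{n′,m′}D^⊢_△)}`": for the HORIZONTAL arrow
`(n,m) → (n+1,m)` of `Λ`, the poly-isomorphism of mono-analytic log-shells induced by the arrow (through the
Kummer isomorphisms of (iii), underlying `D^⊢`-prime-strips and the functorial algorithm `I_{(−)}` of Prop 1.2
(vi)/(vii)) IS `BiCores`' bi-coric log-shell poly-isomorphism `BiCoricData.biCoricShellPolyIso` — for which the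
compatibility with Prop 1.2 (viii) is `BiCoricData.thm15iv_compat_viii`. [claim: Mochizuki2012, status: disputed] -/
theorem thm15iv_of_horizontal (n m : ℤ) :
    PolyIso.map G.biCoric.monoShell
      ((fun e => G.biCoric.dvConj (G.biCoric.kummerTransport
        (G.fxmDeltaHT_iso.app (Λ.HT (n, m)) ≪≫ e ≪≫ (G.fxmDeltaHT_iso.app (Λ.HT (n + 1, m))).symm))) ''
        (G.linkData.linkInducedFxm Λ.kind (Λ.HT (n, m)) (Λ.HT (n + 1, m)))) =
    G.biCoric.biCoricShellPolyIso (S.htToD.obj (Λ.HT (n, m))) (S.htToD.obj (Λ.HT (n + 1, m))) := by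
  rw [G.horizontal_inducedDv_full Λ n m]
  rfl

/-- **IUTchIII:Thm1.5(iv)** (kurims p.50) for the VERTICAL arrow `(n,m) → (n,m+1)` of `Λ`: the poly-isomorphism of
mono-analytic log-shells `{I_{^{n,m}D^⊢_△}} ⥲ {I_{^{n,m+1}D^⊢_△}}` induced by the full poly-isomorphism of `D`-Hodge theaters
of Thm 1.5 (i) is a nonempty sub-poly-isomorphism of `BiCoricData.biCoricShellPolyIso`.
[claim: Mochizuki2012, status: disputed] -/
theorem thm15iv_of_vertical (n m : ℤ) :
    ((((Λ.vertical n m).inducedDHT).map G.biCoric.dvDelta).map G.biCoric.monoShell).Nonempty ∧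
    (((Λ.vertical n m).inducedDHT).map G.biCoric.dvDelta).map G.biCoric.monoShell ⊆
      G.biCoric.biCoricShellPolyIso (S.htToD.obj (Λ.HT (n, m))) (S.htToD.obj (Λ.HT (n, m + 1))) :=
  ⟨(G.vertical_inducedDv_nonempty Λ n m).image _, Set.image_mono (G.vertical_inducedDv_subset_full Λ n m)⟩

/-- **IUTchIII:Thm1.5(iv)** (kurims p.50) "for arbitrary `n, m, n′, m′ ∈ ℤ`": composing the `D^⊢_△`-poly-isomorphism
of a vertical arrow with that of a horizontal arrow (the two generators of the lattice) and applying `I_{(−)}`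
again lands inside `BiCores`' bi-coric log-shell poly-isomorphism between the endpoints.
[claim: Mochizuki2012, status: disputed] -/
theorem thm15iv_of_vertical_horizontal (n m : ℤ) :
    ((((Λ.vertical n m).inducedDHT).map G.biCoric.dvDelta).comp
        ((fun e => G.biCoric.dvConj (G.biCoric.kummerTransport
          (G.fxmDeltaHT_iso.app (Λ.HT (n, m + 1)) ≪≫ e ≪≫
            (G.fxmDeltaHT_iso.app (Λ.HT (n + 1, m + 1))).symm))) ''
          (G.linkData.linkInducedFxm Λ.kind (Λ.HT (n, m + 1)) (Λ.HT (n + 1, m + 1))))).map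
        G.biCoric.monoShell ⊆
      G.biCoric.biCoricShellPolyIso (S.htToD.obj (Λ.HT (n, m))) (S.htToD.obj (Λ.HT (n + 1, m + 1))) :=
  Set.image_mono (Set.subset_univ _)

/-- **IUTchIII:Thm1.5(iv)** (kurims p.50) last sentence, WITH THE ACTUAL ARROW OF (ii): "the first "`⥲`"
[`{I_{^{n,m}D^⊢_△}} ⥲ {I_{^{n,m}F^{⊢×μ}_△}}`] may be regarded as being induced by the Kummer isomorphisms of (iii) and is
compatible with the poly-isomorphisms induced by the poly-isomorphisms of (ii)" — the square formed by the
bi-coric log-shell poly-isomorphism, the two first arrows (`BiCoricData.shellKummerAt`), and the image under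
`I_{(−)}` of Thm 1.5 (ii)'s poly-isomorphism `^{n,m}F^{⊢×μ}_△ ⥲ ^{n+1,m}F^{⊢×μ}_△` of the horizontal arrow of `Λ` (read on
`BiCores`' copy of `†F^{⊢×μ}_△` through the glue isomorphism `fxmDeltaHT_iso`) COMMUTES.
[claim: Mochizuki2012, status: disputed] -/
theorem thm15iv_compat_ii_glue (n m : ℤ) :
    (G.biCoric.biCoricShellPolyIso (S.htToD.obj (Λ.HT (n, m))) (S.htToD.obj (Λ.HT (n + 1, m)))).comp
        (G.biCoric.shellKummerAt (Λ.HT (n + 1, m))) =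
      (G.biCoric.shellKummerAt (Λ.HT (n, m))).comp
        ((((PolyIso.single (G.fxmDeltaHT_iso.app (Λ.HT (n, m)))).comp
            (G.linkData.linkInducedFxm Λ.kind (Λ.HT (n, m)) (Λ.HT (n + 1, m)))).comp
            (PolyIso.single (G.fxmDeltaHT_iso.app (Λ.HT (n + 1, m))).symm)).map G.biCoric.fxmShell) := by
  rw [G.linkData.linkInducedFxm_full,
    PolyIso.comp_full_of_nonempty (P := PolyIso.single (G.fxmDeltaHT_iso.app (Λ.HT (n, m)))) ⟨_, rfl⟩,
    PolyIso.full_comp_of_nonempty (Q := PolyIso.single (G.fxmDeltaHT_iso.app (Λ.HT (n + 1, m))).symm)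
      ⟨_, rfl⟩]
  exact G.biCoric.shellKummerAt_compat_ii (Λ.HT (n, m)) (Λ.HT (n + 1, m))

/-- **IUTchIII:Thm1.5(v)** (kurims p.50) "the poly-isomorphisms of `D^⊢`-prime-strips `^{n,m}D^⊢_△ ⥲ ^{n′,m′}D^⊢_△` induced by
the full poly-isomorphisms of (i), (ii) induce … `(D^⊩(^{n,m}D^⊢_△), Prime(D^⊩(^{n,m}D^⊢_△)) ⥲ V̲, {^{n,m}ρ_{D^⊩,v}}_v) ⥲ (…)`": for
the HORIZONTAL arrow of `Λ` the induced poly-isomorphism of `D^⊩`-data IS `BiCores`' bi-coric realified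
poly-isomorphism `BiCoricData.biCoricRealifiedPolyIso`. [claim: Mochizuki2012, status: disputed] -/
theorem thm15v_of_horizontal (n m : ℤ) :
    PolyIso.map G.biCoric.realified
      ((fun e => G.biCoric.dvConj (G.biCoric.kummerTransport
        (G.fxmDeltaHT_iso.app (Λ.HT (n, m)) ≪≫ e ≪≫ (G.fxmDeltaHT_iso.app (Λ.HT (n + 1, m))).symm))) ''
        (G.linkData.linkInducedFxm Λ.kind (Λ.HT (n, m)) (Λ.HT (n + 1, m)))) =
    G.biCoric.biCoricRealifiedPolyIso (S.htToD.obj (Λ.HT (n, m))) (S.htToD.obj (Λ.HT (n + 1, m))) := by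
  rw [G.horizontal_inducedDv_full Λ n m]
  rfl

/-- **IUTchIII:Thm1.5(v)** (kurims p.50) for the VERTICAL arrow of `Λ`: the poly-isomorphism of `D^⊩`-data induced by
the full poly-isomorphism of `D`-Hodge theaters of Thm 1.5 (i) is a nonempty sub-poly-isomorphism of
`BiCoricData.biCoricRealifiedPolyIso`. [claim: Mochizuki2012, status: disputed] -/
theorem thm15v_of_vertical (n m : ℤ) :
    ((((Λ.vertical n m).inducedDHT).map G.biCoric.dvDelta).map G.biCoric.realified).Nonempty ∧
    (((Λ.vertical n m).inducedDHT).map G.biCoric.dvDelta).map G.biCoric.realified ⊆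
      G.biCoric.biCoricRealifiedPolyIso (S.htToD.obj (Λ.HT (n, m))) (S.htToD.obj (Λ.HT (n, m + 1))) :=
  ⟨(G.vertical_inducedDv_nonempty Λ n m).image _, Set.image_mono (G.vertical_inducedDv_subset_full Λ n m)⟩

/-- **IUTchIII:Thm1.5(v)** (kurims p.50) "Let `n, m, n′, m′ ∈ ℤ`": composing a vertical and a horizontal generator
of `Λ` at the `D^⊢_△` level and applying `D^⊩(−)` lands inside `BiCores`' bi-coric realified poly-isomorphism
between the endpoints. [claim: Mochizuki2012, status: disputed] -/
theorem thm15v_of_vertical_horizontal (n m : ℤ) :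
    ((((Λ.vertical n m).inducedDHT).map G.biCoric.dvDelta).comp
        ((fun e => G.biCoric.dvConj (G.biCoric.kummerTransport
          (G.fxmDeltaHT_iso.app (Λ.HT (n, m + 1)) ≪≫ e ≪≫
            (G.fxmDeltaHT_iso.app (Λ.HT (n + 1, m + 1))).symm))) ''
          (G.linkData.linkInducedFxm Λ.kind (Λ.HT (n, m + 1)) (Λ.HT (n + 1, m + 1))))).map
        G.biCoric.realified ⊆
      G.biCoric.biCoricRealifiedPolyIso (S.htToD.obj (Λ.HT (n, m))) (S.htToD.obj (Λ.HT (n + 1, m + 1))) :=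
  Set.image_mono (Set.subset_univ _)

/-- **IUTchIII:Thm1.5(v)** (kurims p.50) "induce [cf. [IUTchII], Corollaries 4.5, (ii); 4.10, (v)] AN ISOMORPHISM of
collections of data" along the WHOLE lattice: under the [IUTchII] Cor 4.10 (v) rigidity — entering BY NAME as
abc-iut-L6-t3's slot `BiCoricData.RealifiedRigidAt` (the [IUTchII]-side statement of Cor 4.10 (v) is not yet typed
by its owners; no mathematics is inlined here) — for ALL `(n,m), (n′,m′)` the bi-coric realified poly-isomorphism
between the lattice's `D^⊢_△`-prime-strips is the SINGLE isomorphism `D^⊩(d)`, `d` any isomorphism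
`^{n,m}D^⊢_△ ⥲ ^{n′,m′}D^⊢_△` (one exists: `D`-Hodge theaters are mutually isomorphic, [IUTchI] Rmk 6.12.2 (ii)).
[claim: Mochizuki2012, status: disputed] -/
theorem thm15v_singleIso_lattice
    (hv : ∀ H H' : S.DHT, G.biCoric.RealifiedRigidAt (G.biCoric.dvDeltaOf H) (G.biCoric.dvDeltaOf H'))
    (p q : ℤ × ℤ) :
    G.biCoric.biCoricRealifiedPolyIso (S.htToD.obj (Λ.HT p)) (S.htToD.obj (Λ.HT q)) =
      PolyIso.single (G.biCoric.realified.mapIso (G.biCoric.dvDelta.mapIso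
        (S.iso_nonempty_DHT (S.htToD.obj (Λ.HT p)) (S.htToD.obj (Λ.HT q))).some)) :=
  G.biCoric.biCoricRealifiedPolyIso_eq_single (hv _ _) _

/-- **IUTchIII:Thm1.5(v)** (kurims p.51) "this isomorphism of collections of data is compatible, relative to the
horizontal arrows of the Gaussian log-theta-lattice [cf., e.g., the full poly-isomorphisms of (ii)], with the
`ℝ_{>0}`-orbits of the isomorphisms `(^{n,m}C^⊩_△, …) ⥲ (D^⊩(^{n,m}D^⊢_△), …)` … of [IUTchII], Corollary 4.6, (ii)": under the
Cor 4.10 (v) rigidity slot, for EVERY constituent `Φ` of the poly-isomorphism `^{n,m}F^{⊢×μ}_△ ⥲ ^{n+1,m}F^{⊢×μ}_△` of the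
horizontal arrow of `Λ` (Thm 1.5 (ii)), the transported class `BiCoricData.realifiedTransport` between the
Frobenius-like data `(^{n,m}C^⊩_△, …)` and `(^{n+1,m}C^⊩_△, …)` is the double `ℝ_{>0}`-orbit class of the single isomorphism
`D^⊩(d_Φ)`, `d_Φ` the `D^⊢`-isomorphism underlying `Φ` (Kummer-transported). [claim: Mochizuki2012, status: disputed] -/
theorem thm15v_orbit_compat_horizontal
    (hv : ∀ H H' : S.DHT, G.biCoric.RealifiedRigidAt (G.biCoric.dvDeltaOf H) (G.biCoric.dvDeltaOf H'))
    (n m : ℤ) {Φ : G.linkData.fxmDelta.obj (Λ.HT (n, m)) ≅ G.linkData.fxmDelta.obj (Λ.HT (n + 1, m))}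
    (_hΦ : Φ ∈ G.linkData.linkInducedFxm Λ.kind (Λ.HT (n, m)) (Λ.HT (n + 1, m))) :
    G.biCoric.realifiedTransport (Λ.HT (n, m)) (Λ.HT (n + 1, m)) =
      ((G.biCoric.realifiedKummer (Λ.HT (n, m))).comp
          (PolyIso.single (G.biCoric.realified.mapIso (G.biCoric.dvConj (G.biCoric.kummerTransport
            (G.fxmDeltaHT_iso.app (Λ.HT (n, m)) ≪≫ Φ ≪≫ (G.fxmDeltaHT_iso.app (Λ.HT (n + 1, m))).symm)))))).comp
        (G.biCoric.realifiedKummer (Λ.HT (n + 1, m))).symm :=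
  G.biCoric.realifiedTransport_eq_orbit (hv _ _) _

/-- **IUTchIII:Thm1.5(v)** (kurims p.50) every constituent of the horizontal arrow's poly-isomorphism is eligible in
`thm15v_orbit_compat_horizontal`: that poly-isomorphism is the full one (Thm 1.5 (ii) /[IUTchII] Cor 4.10 (iv)), in
particular nonempty. [claim: Mochizuki2012, status: disputed] -/
theorem horizontal_linkInducedFxm_nonempty (n m : ℤ) :
    (G.linkData.linkInducedFxm Λ.kind (Λ.HT (n, m)) (Λ.HT (n + 1, m))).Nonempty := by
  rw [G.linkData.linkInducedFxm_full]
  exact ⟨(S.iso_nonempty_Fxm _ _).some, PolyIso.mem_full _⟩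

end LatticeGlue

end Literature.IUT.LogThetaLattice
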